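import Summits.CriticalPhenomena.CardyFormulaZ2.Theorems.CardyBoundaryCoulombGasHalfPlaneMarkDensityLawReduction

/-!
# Line `Sketch` for the crux `HalfPlaneMarkDensityLaw` (stmt-CriticalPhenomena-5661, route
# CardyBoundaryCoulombGas) — LEAD'S SKELETON, landed form (lead -1, 2026-08-16)

Composition (unchanged from lead -0): the crux BY NAME is `stub_reduction` (tree theorem, p91131:
translation + exact telescoping + four-case inclusion + independence + two-arm point bound + difference
quotient, assembled from the LANDED stubs A `stub_twoArmPoint` p88002, I `stub_symmDiffInclusion` p89355,
P `stub_isolationIndep` p88128, L `stub_shiftLipschitz` p90534, D `stub_densityFromIncrements` p89405 —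
all imported here, none restated) applied to the ONE remaining stub `stub_collinearCardy` = C⁺, the
collinear half-plane Cardy law for bond-`ℤ²` (open-problem strength; `⟸ RectilinearCardy`, stmt-5660,
tree theorem `stub_fromRectilinear` p93337; `⟸ CardyFormulaZ2` by specialisation; `⟺` the crux,
`stub_equivalence` p92261).
-/

noncomputable section

namespace Summit.CriticalPhenomena.CardyFormulaZ2.Cruxes.HalfPlaneMarkDensityLaw.SketchLine

open Literature.Probability.Percolation Literature.Probability.LatticeModels
open Literature.Probability.RandomPlanarGeometry
open MeasureTheory Filter Set
open scoped Topology
open Summit.CriticalPhenomena.CardyFormulaZ2.Theses.CardyBoundaryCoulombGas (HalfPlaneMarkDensityLaw)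
open Summit.CriticalPhenomena.CardyFormulaZ2.Theorems.HalfPlaneMarkDensityLaw.Negative

/-- STUB C⁺ (collinear half-plane Cardy for bond-`ℤ²`, the transfer target; open-problem strength,
`⟸ RectilinearCardy` (stmt-CriticalPhenomena-5660) by RSW box exhaustion, tree `collinearCardy_of_rectilinearCardy`):
for `a < b < c < y`, `P_{1/2}[[⌊an⌋,⌊bn⌋]×{0} ↔ [⌊cn⌋,⌊yn⌋]×{0} in ℤ×ℕ] → F(η(a,b,c,y))`. -/
theorem stub_collinearCardy :
    ∀ a b c y : ℝ, a < b → b < c → c < y →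
      Tendsto (fun n : ℕ ↦ μ.real (openCrossing halfPlane (arcA a b n) (rowIcc ⌊c * n⌋ ⌊y * n⌋))) atTop
        (𝓝 (Literature.Probability.RandomPlanarGeometry.cardyFunction
          (Literature.Probability.RandomPlanarGeometry.crossRatio ![a, b, c, y]))) := by
  sorry

/-- **The crux from the stubs.** `HalfPlaneMarkDensityLaw` (by name) = `stub_reduction` (landed
composition of stubs A, I, P, L, D) applied to STUB C⁺. -/
theorem HalfPlaneMarkDensityLaw_of : HalfPlaneMarkDensityLaw :=
  stub_reduction stub_collinearCardy

end Summit.CriticalPhenomena.CardyFormulaZ2.Cruxes.HalfPlaneMarkDensityLaw.SketchLine
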